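import Summits.QuantumFields.BalabanUV.Beta.RemainderExplicitSecondOrder
import Summits.QuantumFields.BalabanUV.Beta.GAN24.TorusPeriodise
import Literature.MathematicalPhysics.QuantumFieldTheory.Balaban1983to89.B4TorusKernel

/-!
# Beta / RemainderExplicitTorusColumn — BINDER-OWNERS row D4, ROAD P3 (co-owner #3, unit `b2b-balaban-beta-d4-p3`), skeleton leaves
# V2/E3.4 (first half): THE PERIODISED, BAŁABAN-NORMALISED TEST CONFIGURATION ON A FINITE TORUS AND ITS FOUR-COMPONENT DECAY IN THE
# TORUS BLOCK DISTANCE — uniformly in the LEVEL `N = Lc^{j+1}` AND in the VOLUME (unit-torus side `P ≥ 1`)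

HONEST FRAMING (page 1 of everything the β sub-cell writes): discharging `BetaPertH` makes Bałaban's UV stability
UNCONDITIONAL — a real constructive-QFT result; it is NOT the continuum limit and NOT the Clay problem.  HONEST DEPENDENCY
(verbatim): «continuum YM on T⁴ ⇐ BetaPertH ∧ nine spine estimates (0/9 proved); BetaPertH ⇐ (D1) ∧ (D4) ∧ CAP+tail;
G-an2-4 gates asym, D1 and NE2/3/4.»  NOT IN PRINT; OUR BOOKKEEPING.  `[folklore]`: pv17's periodisation bound
(`B4TorusKernel.MultiPeriod.periodise_bound_supNorm`: `Σ_m K(x + Pm)` of a kernel with `‖K y‖ ≤ M e^{−κ|y|∞}` is `≤ M·periodConst κ d·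
e^{−(κ/(d+1))·(torus sup-distance)}`, constant free of the period vector) applied, after re-parametrising the fine variable by its block,
to gan24-leaf-18's periodised minimiser columns `GAN24.TorusPeriodise.Hper` and to the four components of road P3's level-uniform bounds
(`FineReadoutDecay.exists_wH_decay`, `RemainderExplicitGradient.exists_dwH_decay`, `RemainderExplicitSecondOrder.exists_lapVec_wH_decay`,
`RemainderExplicitDivGrad.exists_ddwH_decay`).  No cited fact, no wall binder, no `def … : Prop`; nothing about Bałaban's densities is
asserted.  NOT summit progress.

ABSOLUTE RULE (cell charter, verbatim): "No internally-minted statement may enter as a cited fact. Every hypothesis is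
either kernel-proved in this package or a verbatim quotation of a PUBLISHED theorem with page reference. The manuscript(s)
under audit are NOT citable for their own disputed steps — they are the thing under adjudication; programme-internal
(2001/route/tribunal) claims are never citable."

## Why road P3 wants this (skeleton `HOME/beta/skeletons/D4-b2b-balaban-beta-d4-p3.md` §3 leaves E1/E3.4/V2)

The explicit carrier `𝔈bal k` of the END `RemainderExplicitRoad.ResidualChain.abs_beta1_le` lives on the remainder chain's exhausting
family of FINITE tori (unit torus with `P = N_n·M` sites per direction; fine torus of side `N·P`, `N = L^k`), and its decay field
`ExplicitCarrier.Decay B₃ δ₀` asks for ONE pair `(B₃, δ₀)` for every torus of the family.  The test configuration for the source bond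
`(μ, x)` is the PERIODISATION over the fine period lattice of the Bałaban-normalised column `z ↦ N^{d+2}·wH^{(N)}(z − N·q)` (`q` a lift of
`x`) — gan24-leaf-18's `Hper N (fun _ ↦ P) μ q` times `N^5`.  THIS FILE: its four (3.14)/(4.4)-type components `|h|`, `N·|∇h|`,
`N²·|Δ_vec h|`, `N²·|d d* h|` at a fine point `z` are `≤ C₁·e^{−κ₁·tdist_P(quo_N z − q)}` with ONE `(κ₁, C₁)` for every level AND every
volume (`tdist_P` = the sup-distance on the unit torus `(ℤ/P)^4` between the block of `z` and the source block).  The restriction to a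
localization domain, the `(4.4)`-normed spaces and the `Limit` field are the companion leaves.
-/

noncomputable section

open Finset Filter
open scoped BigOperators
open Literature.Probability.LatticeModels (TorusSite Torus.proj)
open Literature.MathematicalPhysics.QuantumFieldTheory.LatticeForm (quo repZ)
open Literature.MathematicalPhysics.QuantumFieldTheory.Balaban1983to89
open Literature.MathematicalPhysics.QuantumFieldTheory.Balaban1983to89.Beta
open AffineAveraging (Site Form0 Form1 unitVec curv curvAdj dz codiff₁)
open B4ContourShift (supNorm supNorm_nonneg)
open B4TorusKernel (periodConst)
open B4TorusKernel.MultiPeriod (translate torusSupNorm centreVec supNorm_translate_centreVec translate_centreVec_centred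
  torusSupNorm_nonneg periodise_bound periodise_bound_supNorm)
open BlochFibreMatrix (eq_repZ_add_zsmul_quo)
open BlochFibreUniqueness (quo_add_zsmul quo_repZ)
open KernelSpecInstance (wH hasSum_dz hasSum_codiff₁ hasSum_curv hasSum_curvAdj)
open ResolventComposition (Hcol Hcol_apply)
open Summit.QuantumFields.BalabanUV.Beta.GAN24.TorusPeriodise (pshift Hper hasSum_Hper summable_Hcol_pshift)
open Summit.QuantumFields.BalabanUV.Beta.GAN24.FineReadoutDecay (exists_wH_decay)
open Summit.QuantumFields.BalabanUV.Beta.RemainderExplicitGradient (exists_dwH_decay)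
open Summit.QuantumFields.BalabanUV.Beta.RemainderExplicitDivGrad (exists_ddwH_decay)
open Summit.QuantumFields.BalabanUV.Beta.RemainderExplicitSecondOrder (lapVec curvAdj_curv_eq exists_lapVec_wH_decay weaken)

namespace Summit.QuantumFields.BalabanUV.Beta.RemainderExplicitTorusColumn

/-! ## §1 Periodisation of a block-scale-decaying lattice function decays in the torus block distance (every point, any period) -/

section Periodise

variable {d : ℕ}

/-- [folklore] Re-indexing the period sum: `Σ_m K(x + Pm) = Σ_m K(x₀ + Pm)` for the re-centred representative `x₀ = x + P·c`. -/
theorem tsum_translate_recenter (K : Site (d + 1) → ℂ) (P : Fin (d + 1) → ℕ) (x c : Site (d + 1)) :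
    ∑' m : Site (d + 1), K (translate P x m) = ∑' m : Site (d + 1), K (translate P (translate P x c) m) := by
  rw [← (Equiv.addRight c).tsum_eq (fun m => K (translate P x m))]
  refine tsum_congr fun m => ?_
  congr 1
  funext i
  simp only [Equiv.coe_addRight, B4TorusKernel.MultiPeriod.translate_apply, Pi.add_apply]
  ring

/-- [folklore] **PERIODISATION DECAYS IN THE TORUS DISTANCE, AT EVERY POINT**: for `‖K y‖ ≤ M·e^{−κ|y|∞}` (`κ > 0`) and periods `P_i ≥ 1`,
`Σ_m K(x + Pm)` converges absolutely and `‖Σ_m K(x + Pm)‖ ≤ M·periodConst κ d·e^{−(κ/(d+1))·torusSupNorm P x}` for EVERY `x`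
(pv17's centred statement at the centred representative + re-indexing). -/
theorem periodise_decay_torus (K : Site (d + 1) → ℂ) {κ M : ℝ} (hκ : 0 < κ)
    (hK : ∀ y, ‖K y‖ ≤ M * Real.exp (-(κ * supNorm y))) {P : Fin (d + 1) → ℕ} (hP : ∀ i, 1 ≤ P i) (x : Site (d + 1)) :
    Summable (fun m : Site (d + 1) => K (translate P x m)) ∧
      ‖∑' m : Site (d + 1), K (translate P x m)‖ ≤ M * periodConst κ d * Real.exp (-(κ / (d + 1) * torusSupNorm P x)) := by
  set x₀ := translate P x (centreVec P x) with hx₀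
  have hc : ∀ i, 2 * |x₀ i| ≤ P i := translate_centreVec_centred hP x
  constructor
  · -- summability is translation invariant in the index
    have hs := (periodise_bound K hκ hK hP x₀ hc).1
    have e : (fun m : Site (d + 1) => K (translate P x m))
        = (fun m => K (translate P x₀ m)) ∘ (Equiv.addRight (-centreVec P x)) := by
      funext m
      simp only [Function.comp_apply, Equiv.coe_addRight, hx₀]
      congr 1; funext i; simp only [B4TorusKernel.MultiPeriod.translate_apply, Pi.add_apply, Pi.neg_apply]; ring
    rw [e]
    exact hs.comp_injective (Equiv.injective _)
  · rw [tsum_translate_recenter K P x (centreVec P x), ← supNorm_translate_centreVec hP x]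
    exact periodise_bound_supNorm K hκ hK hP x₀ hc

/-- [folklore] The real-valued form: `|Σ_m f(x + Pm)| ≤ M·periodConst κ d·e^{−(κ/(d+1))·torusSupNorm P x}` and summability. -/
theorem periodise_decay_torus_real (f : Site (d + 1) → ℝ) {κ M : ℝ} (hκ : 0 < κ)
    (hf : ∀ y, |f y| ≤ M * Real.exp (-(κ * supNorm y))) {P : Fin (d + 1) → ℕ} (hP : ∀ i, 1 ≤ P i) (x : Site (d + 1)) :
    Summable (fun m : Site (d + 1) => f (translate P x m)) ∧
      |∑' m : Site (d + 1), f (translate P x m)| ≤ M * periodConst κ d * Real.exp (-(κ / (d + 1) * torusSupNorm P x)) := by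
  have hK : ∀ y, ‖((f y : ℝ) : ℂ)‖ ≤ M * Real.exp (-(κ * supNorm y)) := fun y => by
    rw [Complex.norm_real, Real.norm_eq_abs]; exact hf y
  obtain ⟨hs, hb⟩ := periodise_decay_torus (fun y => ((f y : ℝ) : ℂ)) hκ hK hP x
  have hs' : Summable (fun m : Site (d + 1) => f (translate P x m)) := by
    have := Complex.summable_ofReal.mp hs
    exact this
  refine ⟨hs', ?_⟩
  rw [← Complex.ofReal_tsum, Complex.norm_real, Real.norm_eq_abs] at hb
  exact hb

/-! ### The block re-parametrisation: a fine-lattice function bounded on the BLOCK scale, periodised over `N·P·ℤ^{d+1}` -/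

variable {N : ℕ} [NeZero N]

/-- [folklore] `z' + N•v = repZ (proj z') + N•(quo z' + v)`. -/
theorem add_zsmul_eq_repZ_add (z' v : Site (d + 1)) :
    z' + (N : ℤ) • v = repZ (Torus.proj N z') + (N : ℤ) • (quo N z' + v) := by
  have h := eq_repZ_add_zsmul_quo (N := N) z'
  rw [smul_add, ← add_assoc, ← h]

/-- [folklore] `u + pshift P t = translate P u t`. -/
theorem add_pshift_eq_translate (P : Fin (d + 1) → ℕ) (u t : Site (d + 1)) : u + pshift P t = translate P u t := by
  funext i; simp [pshift, B4TorusKernel.MultiPeriod.translate_apply]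

/-- [folklore] **BLOCK-SCALE PERIODISATION BOUND**: if `|g w| ≤ C·e^{−κ‖quo_N w‖∞}` for every fine point `w` (`κ > 0`), then for every
fine point `z'` and every period vector `P ≥ 1` the sum over the fine period lattice `N·P·ℤ^{d+1}` converges absolutely and
`|Σ_t g(z' + N•pshift P t)| ≤ C·periodConst κ d·e^{−(κ/(d+1))·torusSupNorm P (quo_N z')}`. -/
theorem periodise_block_decay (g : Site (d + 1) → ℝ) {κ C : ℝ} (hκ : 0 < κ)
    (hg : ∀ w, |g w| ≤ C * Real.exp (-(κ * supNorm (quo N w)))) {P : Fin (d + 1) → ℕ} (hP : ∀ i, 1 ≤ P i) (z' : Site (d + 1)) :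
    Summable (fun t : Site (d + 1) => g (z' + (N : ℤ) • pshift P t)) ∧
      |∑' t : Site (d + 1), g (z' + (N : ℤ) • pshift P t)|
        ≤ C * periodConst κ d * Real.exp (-(κ / (d + 1) * torusSupNorm P (quo N z'))) := by
  -- the block kernel `K y := g (repZ (proj z') + N•y)`
  set K : Site (d + 1) → ℝ := fun y => g (repZ (Torus.proj N z') + (N : ℤ) • y) with hK
  have hKb : ∀ y, |K y| ≤ C * Real.exp (-(κ * supNorm y)) := fun y => by
    have := hg (repZ (Torus.proj N z') + (N : ℤ) • y)
    rwa [quo_add_zsmul, quo_repZ, zero_add] at this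
  have e : (fun t : Site (d + 1) => g (z' + (N : ℤ) • pshift P t)) = fun t => K (translate P (quo N z') t) := by
    funext t
    simp only [hK]
    rw [add_zsmul_eq_repZ_add, add_pshift_eq_translate]
  rw [e]
  exact periodise_decay_torus_real K hκ hKb hP (quo N z')

end Periodise

/-! ## §2 The periodised minimiser column: its values and its three stencils as period sums -/

section Column

variable {d N : ℕ} [NeZero N] (P : Fin (d + 1) → ℕ) [∀ ν, NeZero (P ν)]

omit [∀ ν, NeZero (P ν)] in
/-- [folklore] The summand of `Hper` is the fine-period translate: `Hcol N μ (q − pshift P t) κ z = wH κ μ ((z − N•q) + N•pshift P t)`. -/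
theorem Hcol_pshift_apply (μ : Fin (d + 1)) (q t : Site (d + 1)) (κ : Fin (d + 1)) (z : Site (d + 1)) :
    Hcol (N := N) μ (q - pshift P t) κ z = wH (N := N) κ μ ((z - (N : ℤ) • q) + (N : ℤ) • pshift P t) := by
  rw [Hcol_apply]; congr 1; rw [smul_sub]; abel

/-- [folklore] `Hper` pointwise as the period sum of `wH` over the fine period lattice. -/
theorem hasSum_Hper_wH (μ : Fin (d + 1)) (q : Site (d + 1)) (κ : Fin (d + 1)) (z : Site (d + 1)) :
    HasSum (fun t : Site (d + 1) => wH (N := N) κ μ ((z - (N : ℤ) • q) + (N : ℤ) • pshift P t)) (Hper N P μ q κ z) := by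
  have h := hasSum_Hper N P μ q κ z
  simp only [Hcol_pshift_apply] at h
  exact h

/-- [folklore] `lapVec` of a pointwise `HasSum` family of 1-forms. -/
theorem hasSum_lapVec {ι : Type*} {F : ι → Form1 (d + 1) ℝ} {A : Form1 (d + 1) ℝ} (h : ∀ κ x, HasSum (fun i => F i κ x) (A κ x))
    (ν : Fin (d + 1)) (x : Site (d + 1)) : HasSum (fun i => lapVec (F i) ν x) (lapVec A ν x) := by
  simp only [lapVec]
  refine hasSum_sum fun μ _ => ?_
  have h2 : HasSum (fun i => 2 * F i ν x) (2 * A ν x) := (h ν x).mul_left 2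
  exact (h2.sub (h ν (x + unitVec μ))).sub (h ν (x - unitVec μ))

/-- [folklore] `Δ_vec` commutes with translations: `Δ_vec (A(· − v)) ν x = (Δ_vec A) ν (x − v)`. -/
theorem lapVec_translate (A : Form1 (d + 1) ℝ) (v : Site (d + 1)) (ν : Fin (d + 1)) (x : Site (d + 1)) :
    lapVec (fun κ z => A κ (z - v)) ν x = lapVec A ν (x - v) := by
  simp only [lapVec]
  refine Finset.sum_congr rfl fun μ _ => ?_
  rw [show x + unitVec μ - v = x - v + unitVec μ by abel, show x - unitVec μ - v = x - v - unitVec μ by abel]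

/-- [folklore] `dz ∘ codiff₁` commutes with translations. -/
theorem dz_codiff₁_translate (A : Form1 (d + 1) ℝ) (v : Site (d + 1)) (ν : Fin (d + 1)) (x : Site (d + 1)) :
    dz (codiff₁ (fun κ z => A κ (z - v))) ν x = dz (codiff₁ A) ν (x - v) := by
  simp only [dz, codiff₁]
  have h1 : ∀ κ : Fin (d + 1), x + unitVec ν - unitVec κ - v = x - v + unitVec ν - unitVec κ := fun κ => by abel
  have h2 : ∀ κ : Fin (d + 1), x - unitVec κ - v = x - v - unitVec κ := fun κ => by abel
  simp only [h1, h2, show x + unitVec ν - v = x - v + unitVec ν by abel]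

omit [NeZero N] [∀ ν, NeZero (P ν)] in
/-- [folklore] The translated column read at `z`: `Hcol N μ q' κ z = wH κ μ (z − N•q')` with `q' = q − pshift P t` gives the point
`(z − N•q) + N•pshift P t`. -/
theorem sub_zsmul_sub_pshift (q t z : Site (d + 1)) :
    z - (N : ℤ) • (q - pshift P t) = (z - (N : ℤ) • q) + (N : ℤ) • pshift P t := by
  rw [smul_sub]; abel

end Column

end Summit.QuantumFields.BalabanUV.Beta.RemainderExplicitTorusColumn

end
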